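import Literature.NumberTheory.Transcendental.KZFibredRelations
import Literature.NumberTheory.Transcendental.KZSemiCanonicalReductionProofs
import Literature.NumberTheory.Transcendental.KZLogCalculusProofs

/-!
# `CubeKernelStep` (stmt-KontsevichZagierPeriods-17854) — line `Sketch`, stub `stub_slabGluing`

**Slab gluing.** If the restrictions of a closed `(d+1)`-cube representation `t` to the open slabs
`{k/N < z 0 < (k+1)/N}`, `k < N`, of a rational equipartition of the parameter interval `[0,1]`
are KZ relations, then so is `t`. The slab domains `t.domain ∩ {k/N < z 0 < (k+1)/N}`
(`KZ.IntegralRep.slabRestrict`) lie in the cube, carry the integrand of `t`, are pairwise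
disjoint, and cover the cube off the grid hyperplanes `{z 0 = k/N}`, which are Lebesgue-null
(`MeasureTheory.Measure.pi_hyperplane`); hence `[t] − Σ_{k<N} [t|slab k] ∈ relations` by iterated
domain additivity (`KZ.of_sub_sum_of_mem_relations`, rule (1a) of [Kontsevich–Zagier 2001,
§1.2]), and the sum is a relation by hypothesis. Pure bookkeeping; no transcendence.

References: M. Kontsevich, D. Zagier, *Periods* (2001), §1.2 (rule (1): additivity in the
domain, integrands may be changed on null sets).
-/

noncomputable section

-- `Summit.KontsevichZagierPeriods.KontsevichZagierPeriods.…` is the tree's mandated layout.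
set_option linter.dupNamespace false

namespace Summit.KontsevichZagierPeriods.KontsevichZagierPeriods.Cruxes.CubeKernelStep.Layers

open MeasureTheory Set
open Literature.NumberTheory.Transcendental
open Literature.NumberTheory.Transcendental.KZ

/-- A coordinate hyperplane `{z 0 = c}` of `ℝ^{d+1}` is Lebesgue-null (Lebesgue measure on
`Fin (d+1) → ℝ` is the product measure, and `{c}` is null in `ℝ`). [folklore] -/
private theorem slabGluing_volume_hyperplane (d : ℕ) (c : ℝ) :
    volume {z : Fin (d + 1) → ℝ | z 0 = c} = 0 := by
  rw [volume_pi]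
  exact Measure.pi_hyperplane (fun _ : Fin (d + 1) => (volume : Measure ℝ)) 0 c

/-- The grid hyperplanes `{z 0 = k/N}`, `k ∈ ℕ`, of `ℝ^{d+1}` form a Lebesgue-null set (a countable
union of null hyperplanes). [folklore] -/
private theorem slabGluing_volume_grid (d N : ℕ) :
    volume (⋃ k : ℕ, {z : Fin (d + 1) → ℝ | z 0 = (k : ℝ) / N}) = 0 :=
  measure_iUnion_null fun _ => slabGluing_volume_hyperplane d _

/-- Off the grid `{k/N | k ∈ ℕ}`, every point of `[0,1]` lies in one of the open intervals
`(k/N, (k+1)/N)` with `k < N` (take `k = ⌊x N⌋`). [folklore] -/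
private theorem slabGluing_exists_index {N : ℕ} (hN : 0 < N) {x : ℝ} (hx : x ∈ Icc (0:ℝ) 1)
    (hgrid : ∀ k : ℕ, x ≠ (k : ℝ) / N) :
    ∃ k : ℕ, k < N ∧ (k : ℝ) / N < x ∧ x < ((k : ℝ) + 1) / N := by
  have hNpos : (0:ℝ) < N := by exact_mod_cast hN
  have h1 : (⌊x * N⌋₊ : ℝ) < x * N :=
    lt_of_le_of_ne (Nat.floor_le (mul_nonneg hx.1 hNpos.le)) fun h =>
      hgrid _ (by rw [h, mul_div_cancel_right₀ _ hNpos.ne'])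
  refine ⟨⌊x * N⌋₊, ?_, (div_lt_iff₀ hNpos).mpr h1,
    (lt_div_iff₀ hNpos).mpr (Nat.lt_floor_add_one _)⟩
  have h2 : (⌊x * N⌋₊ : ℝ) < N := h1.trans_le (mul_le_of_le_one_left hNpos.le hx.2)
  exact_mod_cast h2

/-- Two open intervals `(i/N, (i+1)/N)` and `(j/N, (j+1)/N)` of the equipartition that share a point
have the same index. [folklore] -/
private theorem slabGluing_index_unique {N i j : ℕ} (hN : 0 < N) {x : ℝ}
    (hi : (i : ℝ) / N < x) (hi' : x < ((i : ℝ) + 1) / N)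
    (hj : (j : ℝ) / N < x) (hj' : x < ((j : ℝ) + 1) / N) : i = j := by
  have hNpos : (0:ℝ) < N := by exact_mod_cast hN
  have h1 : (i : ℝ) < j + 1 := (div_lt_div_iff_of_pos_right hNpos).mp (hi.trans hj')
  have h2 : (j : ℝ) < i + 1 := (div_lt_div_iff_of_pos_right hNpos).mp (hj.trans hi')
  have h1' : i < j + 1 := by exact_mod_cast h1
  have h2' : j < i + 1 := by exact_mod_cast h2
  omega

/-- **Slab gluing (registered stub `stub_slabGluing`).** If the restrictions of a closed
`(d+1)`-cube representation to the open slabs `{k/N < z 0 < (k+1)/N}`, `k < N`, of a rational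
equipartition of the parameter interval are relations, so is the representation: the slab
domains lie in the cube, carry its integrand, are pairwise disjoint and cover the cube off the
null grid hyperplanes `{z 0 = k/N}`, so `[t] − Σ_k [t|slab k]` is a relation by iterated domain
additivity (`KZ.of_sub_sum_of_mem_relations`), and `Σ_k [t|slab k]` is a relation by hypothesis.
[cite: KontsevichZagier2001, §1.2 rule (1)] -/
theorem stub_slabGluing :
    ∀ (d : ℕ) (t : IntegralRep (d + 1)),
      t.domain = Set.pi Set.univ (fun _ : Fin (d + 1) => Set.Icc (0:ℝ) 1) →
      ∀ N : ℕ, 0 < N →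
        (∀ k : ℕ, k < N → of (t.slabRestrict ((k : ℚ) / N) (((k : ℚ) + 1) / N)) ∈ relations) →
        of t ∈ relations := by
  intro d t htd N hN hk
  classical
  -- the ends of the `k`-th slab, cast to `ℝ`
  have hc1 : ∀ k : ℕ, (((k : ℚ) / N : ℚ) : ℝ) = (k : ℝ) / N := fun k => by
    push_cast; ring
  have hc2 : ∀ k : ℕ, ((((k : ℚ) + 1) / N : ℚ) : ℝ) = ((k : ℝ) + 1) / N := fun k => by
    push_cast; ring
  -- membership in the `k`-th slab domain
  have hmem : ∀ (k : ℕ) (z : Fin (d + 1) → ℝ),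
      z ∈ (t.slabRestrict ((k : ℚ) / N) (((k : ℚ) + 1) / N)).domain ↔
        z ∈ t.domain ∧ (k : ℝ) / N < z 0 ∧ z 0 < ((k : ℝ) + 1) / N := by
    intro k z
    rw [IntegralRep.domain_slabRestrict, mem_inter_iff, mem_paramSlab, hc1, hc2]
  -- (i) the slab domains lie in the cube
  have hdom : ∀ k ∈ Finset.range N,
      volume ((t.slabRestrict ((k : ℚ) / N) (((k : ℚ) + 1) / N)).domain \ t.domain) = 0 :=
    fun k _ => measure_mono_null (fun z hz => (hz.2 hz.1.1).elim) measure_empty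
  -- (ii) the slab restrictions carry the integrand of `t`
  have hint : ∀ k ∈ Finset.range N,
      EqOn (t.slabRestrict ((k : ℚ) / N) (((k : ℚ) + 1) / N)).integrand t.integrand
        ((t.slabRestrict ((k : ℚ) / N) (((k : ℚ) + 1) / N)).domain ∩ t.domain) :=
    fun _ _ _ _ => rfl
  -- (iii) the slabs cover the cube off the null grid hyperplanes `{z 0 = k/N}`
  have hcov : volume (t.domain \ ⋃ k ∈ Finset.range N,
      (t.slabRestrict ((k : ℚ) / N) (((k : ℚ) + 1) / N)).domain) = 0 := by
    refine measure_mono_null ?_ (slabGluing_volume_grid d N)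
    rintro z ⟨hzt, hzU⟩
    have hz01 : z 0 ∈ Icc (0:ℝ) 1 := by
      rw [htd] at hzt
      exact hzt 0 (mem_univ _)
    by_contra hgrid
    simp only [mem_iUnion, mem_setOf_eq, not_exists] at hgrid
    obtain ⟨k, hkN, hk1, hk2⟩ := slabGluing_exists_index hN hz01 hgrid
    exact hzU (mem_iUnion₂.mpr ⟨k, Finset.mem_range.mpr hkN, (hmem k z).mpr ⟨hzt, hk1, hk2⟩⟩)
  -- (iv) distinct slabs are disjoint
  have hdisj : (↑(Finset.range N) : Set ℕ).Pairwise fun i j =>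
      volume ((t.slabRestrict ((i : ℚ) / N) (((i : ℚ) + 1) / N)).domain ∩
        (t.slabRestrict ((j : ℚ) / N) (((j : ℚ) + 1) / N)).domain) = 0 := by
    intro i _ j _ hij
    refine measure_mono_null (fun z hz => (hij ?_).elim) measure_empty
    obtain ⟨-, hi1, hi2⟩ := (hmem i z).mp hz.1
    obtain ⟨-, hj1, hj2⟩ := (hmem j z).mp hz.2
    exact slabGluing_index_unique hN hi1 hi2 hj1 hj2
  -- iterated domain additivity: `[t] − Σ_k [t|slab k] ∈ relations`
  have hsub := of_sub_sum_of_mem_relations (Finset.range N) t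
    (fun k => t.slabRestrict ((k : ℚ) / N) (((k : ℚ) + 1) / N)) hdom hint hcov hdisj
  -- and `Σ_k [t|slab k] ∈ relations` by hypothesis
  have hsum : ∑ k ∈ Finset.range N,
      of (t.slabRestrict ((k : ℚ) / N) (((k : ℚ) + 1) / N)) ∈ relations :=
    sum_mem fun k hk' => hk k (Finset.mem_range.mp hk')
  simpa using relations.add_mem hsub hsum

end Summit.KontsevichZagierPeriods.KontsevichZagierPeriods.Cruxes.CubeKernelStep.Layers

end
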